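import Mathlib.Analysis.SpecialFunctions.Log.Basic
import Mathlib.Analysis.SpecialFunctions.Exp
import Mathlib.Analysis.Calculus.Deriv.Basic
import Mathlib.Analysis.Calculus.ContDiff.Defs
import Mathlib.MeasureTheory.Integral.IntervalIntegral.Basic
import Literature.NumberTheory.LFunctions.LevinsonShortMollifierProportion
import HarnessLib

/-!
# Levinson–Conrey with short mollifiers: a positive proportion for every mollifier length
# (Conrey–Farmer–Kwan–Lin–Turnage-Butterbaugh 2025, Theorem 1)

Topic `Literature/NumberTheory/LFunctions` (namespace `Literature.NumberTheory.LFunctions`).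
STATEMENT LAYER (D-0014: sorry-free; one named `Prop` fact, nothing asserted), typed for the
LANDAU–SIEGEL PROGRAMME (cell `landau-siegel`, §C harvest topic r4, HOME/lit/r4/ROWS.md r4-P06 /
r4-T08, tag "detector": optimisation of the DETECTOR weight `Q` in Levinson–Conrey's method).
The programme SEARCHES and TYPES; no claim about Landau–Siegel zeros is made here.

## Source (arXiv TeX, read 2026-08-26)

J. B. Conrey, D. W. Farmer, C.-H. Kwan, Y. Lin, C. L. Turnage-Butterbaugh, *Short mollifiers of the
Riemann zeta-function*, arXiv:2508.11108 (2025) [bib: `ConreyFarmerKwanLinTurnageButterbaugh2025`].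

§2.1 (set-up, after Conrey 1989): `P` a polynomial with `P(0) = 0`, `P(1) = 1`; `Q` with
`Q(0) = 1`, `Q(y) + Q(1 − y) = 1` (for polynomials: `Q′(y) = Q′(1−y)`), extended to all
`Q ∈ C¹[0,1]` with these two conditions; `R > 0`; mollifier `M(s, P) = Σ_{n ≤ y} μ(n) n^{−(s+1/2−a)}
P(log(y/n)/log y)`, `y = T^θ`, `a = 1/2 − R/log(T/2π)`. "If `θ > 0` is an admissible constant such
that `(1/T)∫₀^T |Q(−(1/L) d/ds)ζ(a+it) M(a+it,P)|² dt ∼ c(P,Q,R)` … then the proportion of zeros of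
`ζ(s)` on the critical line is at least `κ := 1 − (log c(P,Q,R))/R`", and "By [Con89], the constant
`c(P,Q,R)` is given by `1 + (1/θ) ∫₀¹∫₀¹ (w(y)P′(x) + θ w′(y) P(x))² dx dy`, where `w(y) := e^{Ry} Q(y)`."

* **Theorem 1 (§2.1).** "There exists `θ₀ > 0` such that whenever `θ ∈ (0, θ₀)`, there exists
  `Q = Q_θ ∈ C¹[0,1]` satisfying [`Q(0) = 1`, `Q(y) + Q(1−y) = 1`] such that `κ` defined in
  [`κ := 1 − (log c(P,Q,R))/R`] satisfies `κ > 2θ/3 > 0`." (With Levinson's `P(x) = x`; the proof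
  works under the simplifying relation `θ = R⁻¹√(3/5)` and solves the Euler–Lagrange equation of the
  variational problem in `₂F₁`-hypergeometric functions; numerically `κ > (2/3)θ` for all
  `0 < θ ≤ 1/2`. Proposition 1: `Q_θ →` Siegel's step function as `θ → 0⁺`.)

## Rendering choices

* What is typed is the printed statement about the explicit functional `κ(P,Q,R,θ) = 1 −
  log c(P,Q,R,θ)/R` — an analysis statement (no zeta zeros): the zero-proportion reading needs
  the mean-value asymptotic for admissible `θ` (Conrey: `θ < 4/7`; the tree's Levinson framework
  `Literature/NumberTheory/LFunctions/LevinsonMethodConditional.lean`, `Conrey1989MeanValue.lean`,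
  whose `c(P, Q, R, θ)` display is the same functional written with `e^{2Rv}(QP′ + θQ′P + θRQP)²`).
* `Q ∈ C¹[0,1]` = `ContDiffOn ℝ 1 Q [0,1]`; `w′` = `deriv` (a.e. on `[0,1]` suffices inside the
  integral). `R`: "let `R > 0` be any constant", fixed in the proof by `θ = R⁻¹√(3/5)` — typed as
  `∃ R > 0` (weaker than naming `R = √(3/5)/θ`; nothing stronger than print is asserted).
  `P(x) = x` as in the source's (linearP).

## References
* [ConreyFarmerKwanLinTurnageButterbaugh2025] §1.2, §2.1 (set-up, Theorem 1 = `precimain`),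
  §2.2–§3 (variational problem), Proposition 1.
* [Conrey1989] Theorem 2 (the constant `c(P,Q,R,θ)`), tree `Conrey1989MeanValue.lean`.
-/

noncomputable section

open MeasureTheory intervalIntegral

namespace Literature.NumberTheory.LFunctions

namespace CFKLT2025

/-- `w(y) := e^{Ry} Q(y)`. [cite: ConreyFarmerKwanLinTurnageButterbaugh2025, §2.1] -/
def w (Q : ℝ → ℝ) (R : ℝ) (y : ℝ) : ℝ := Real.exp (R * y) * Q y

/-- Conrey's mean-square constant
`c(P,Q,R) = 1 + (1/θ) ∫₀¹∫₀¹ (w(y)P′(x) + θ w′(y) P(x))² dx dy`, `w = e^{Ry}Q`.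
[cite: ConreyFarmerKwanLinTurnageButterbaugh2025, §2.1 (display after Theorem-set-up, from [Con89])] -/
def conreyConstant (P Q : ℝ → ℝ) (R θ : ℝ) : ℝ :=
  1 + (1 / θ) * ∫ y in (0 : ℝ)..1, ∫ x in (0 : ℝ)..1,
    (w Q R y * deriv P x + θ * deriv (w Q R) y * P x) ^ 2

/-- Levinson–Conrey's proportion `κ := 1 − (log c(P,Q,R))/R`.
[cite: ConreyFarmerKwanLinTurnageButterbaugh2025, §2.1 (kappaprop)] -/
def kappa (P Q : ℝ → ℝ) (R θ : ℝ) : ℝ := 1 - Real.log (conreyConstant P Q R θ) / R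

/-- Admissible detector weights: `Q ∈ C¹[0,1]`, `Q(0) = 1`, `Q(y) + Q(1−y) = 1` on `[0,1]`.
[cite: ConreyFarmerKwanLinTurnageButterbaugh2025, §2.1 (Q-funcopt)] -/
def AdmissibleQ (Q : ℝ → ℝ) : Prop :=
  ContDiffOn ℝ 1 Q (Set.Icc 0 1) ∧ Q 0 = 1 ∧ ∀ y ∈ Set.Icc (0 : ℝ) 1, Q y + Q (1 - y) = 1

/-- An admissible `Q` takes the value `1/2` at the centre and `0` at `1`.
[cite: ConreyFarmerKwanLinTurnageButterbaugh2025, §2.2 (S(0) = 1/2, S(R) = 0)] -/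
theorem AdmissibleQ.half_and_one {Q : ℝ → ℝ} (h : AdmissibleQ Q) : Q (1 / 2) = 1 / 2 ∧ Q 1 = 0 := by
  obtain ⟨-, h0, hsym⟩ := h
  have h1 := hsym (1 / 2) ⟨by norm_num, by norm_num⟩
  have h2 := hsym 0 ⟨le_rfl, by norm_num⟩
  norm_num at h1 h2
  constructor
  · linarith
  · linarith

end CFKLT2025

open CFKLT2025

/-- **Conrey–Farmer–Kwan–Lin–Turnage-Butterbaugh 2025, Theorem 1** (NAMED FACT, not proved here):
there is `θ₀ > 0` such that for every `θ ∈ (0, θ₀)` there are `R > 0` and an admissible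
`Q = Q_θ ∈ C¹[0,1]` (`Q(0) = 1`, `Q(y)+Q(1−y) = 1`) with `κ = 1 − log c(P,Q,R)/R > 2θ/3 > 0` for
Levinson's `P(x) = x` — Levinson–Conrey's method yields a positive proportion however short the
mollifier (in print `R = √(3/5)/θ`).
[cite: ConreyFarmerKwanLinTurnageButterbaugh2025, Theorem 1 (§2.1)] -/
def conreyFarmerKwanLinTurnageButterbaugh2025_theorem1 : Prop :=
  ∃ θ₀ : ℝ, 0 < θ₀ ∧ ∀ θ : ℝ, 0 < θ → θ < θ₀ →
    ∃ R : ℝ, 0 < R ∧ ∃ Q : ℝ → ℝ, AdmissibleQ Q ∧ 2 * θ / 3 < kappa (fun x => x) Q R θ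

/-- The printed "`> 2θ/3 > 0`": the guaranteed proportion is positive.
[cite: ConreyFarmerKwanLinTurnageButterbaugh2025, Theorem 1] -/
theorem conreyFarmerKwanLinTurnageButterbaugh2025_theorem1.pos
    (h : conreyFarmerKwanLinTurnageButterbaugh2025_theorem1) :
    ∃ θ₀ : ℝ, 0 < θ₀ ∧ ∀ θ : ℝ, 0 < θ → θ < θ₀ →
      ∃ R : ℝ, 0 < R ∧ ∃ Q : ℝ → ℝ, AdmissibleQ Q ∧ 0 < kappa (fun x => x) Q R θ := by
  obtain ⟨θ₀, hθ₀, H⟩ := h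
  refine ⟨θ₀, hθ₀, fun θ hθ hθ' => ?_⟩
  obtain ⟨R, hR, Q, hQ, hκ⟩ := H θ hθ hθ'
  exact ⟨R, hR, Q, hQ, lt_trans (by positivity) hκ⟩

/-! ### Alias with the decl of record (`LevinsonShortMollifierProportion.lean`, ls-lit-r5)

The same printed theorem was typed twice in the cell (crossing claims, 2026-08-26); the decl OF
RECORD is `cfklt2025_shortMollifiers_theorem1` (ruling of ls-lit-lead, INBOX 16:44:59Z). The two
renderings have the SAME constant `c(P,Q,R)` and proportion `κ` (checked below by `rfl`-level
unfolding) and differ only in the smoothness clause of the admissible detector: there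
`ContDiff ℝ 1 Q` (globally `C¹`), here `ContDiffOn ℝ 1 Q [0,1]` (the printed "`Q ∈ C¹[0,1]`").
Hence the decl of record IMPLIES the one of this file (proved); the converse would need a `C¹`
extension from `[0,1]` to `ℝ` together with an a.e.-equality of the integrands and is not
formalised (no mathematical discrepancy: the source's `Q_θ` is real-analytic). -/

/-- The two typed Conrey constants agree. [cite: ConreyFarmerKwanLinTurnageButterbaugh2025, §2.1] -/
theorem CFKLT2025.conreyConstant_eq (P Q : ℝ → ℝ) (R θ : ℝ) :
    CFKLT2025.conreyConstant P Q R θ = ShortMollifiers.conreyLevinsonConst θ R P Q := by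
  unfold CFKLT2025.conreyConstant ShortMollifiers.conreyLevinsonConst CFKLT2025.w
  rw [one_div]

/-- The two typed proportions `κ` agree. [cite: ConreyFarmerKwanLinTurnageButterbaugh2025, §2.1] -/
theorem CFKLT2025.kappa_eq (P Q : ℝ → ℝ) (R θ : ℝ) :
    CFKLT2025.kappa P Q R θ = ShortMollifiers.levinsonProportion θ R P Q := by
  rw [CFKLT2025.kappa, ShortMollifiers.levinsonProportion, CFKLT2025.conreyConstant_eq]

/-- A globally `C¹` admissible detector is admissible on `[0,1]`.
[cite: ConreyFarmerKwanLinTurnageButterbaugh2025, §2.1 (Q-funcopt)] -/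
theorem CFKLT2025.AdmissibleQ.of_isAdmissibleQ {Q : ℝ → ℝ} (h : ShortMollifiers.IsAdmissibleQ Q) :
    CFKLT2025.AdmissibleQ Q :=
  ⟨h.1.contDiffOn, h.2.1, h.2.2⟩

/-- **Alias**: the decl of record `cfklt2025_shortMollifiers_theorem1` implies this file's rendering
of Theorem 1 (same `c`, same `κ`, weaker smoothness clause).
[cite: ConreyFarmerKwanLinTurnageButterbaugh2025, Theorem 1] -/
theorem conreyFarmerKwanLinTurnageButterbaugh2025_theorem1_of_record
    (h : cfklt2025_shortMollifiers_theorem1) : conreyFarmerKwanLinTurnageButterbaugh2025_theorem1 := by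
  obtain ⟨θ₀, hθ₀, H⟩ := h
  refine ⟨θ₀, hθ₀, fun θ hθ hθ' => ?_⟩
  obtain ⟨R, hR, Q, hQ, hκ⟩ := H θ hθ hθ'
  refine ⟨R, hR, Q, CFKLT2025.AdmissibleQ.of_isAdmissibleQ hQ, ?_⟩
  rwa [CFKLT2025.kappa_eq]

end Literature.NumberTheory.LFunctions
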